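import Mathlib
import Summits.AtomisticToContinuum.FouriersLaw.Theorems.BondHeatUncertaintyPositiveOrInfiniteLimitSlots
import Summits.AtomisticToContinuum.FouriersLaw.Theorems.BondHeatUncertaintyTransferToBoundedResponse

/-!
# Route `BondHeatUncertainty` — the import slot `PositiveOrInfiniteLimit` is, ALONG THIS ROUTE, exactly
# the shared crux `BoundedResponseConverges`; the re-pointed deciding theorem

Support for item `stmt-AtomisticToContinuum-9128`
(`Summit.AtomisticToContinuum.FouriersLaw.Theses.BondHeatUncertainty.PositiveOrInfiniteLimit`).

The slot (under weak-NESS uniqueness, `↑(D N) → ℓ ∈ (0, +∞]` in `EReal` along every steady-state family)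
is the positivity-and-convergence half of Fourier's law for `pinnedChain ω₂ lam β γ` and is open
(companion files `BondHeatUncertaintyPositiveOrInfiniteLimit{,Eventual,Harmonic,Slots,Split}.lean`
record every by-name supply line and the necessity of `JunctionLocality.ConductanceLowerBound`).
This file records the two facts a planner needs to take item 9128 OFF this route:

* `positiveOrInfiniteLimit_iff_boundedResponseConverges_of_route` — given the route's own three cruxes
  (S) `SubdiffusiveBondHeat`, (K) `ExtensiveSnapshotIrreversibility`, (★) `LinearResponseFTUR` and
  `NessUnique`, the slot is EQUIVALENT to the shared crux
  `LocalOhmBV.BoundedResponseConverges` (item `stmt-AtomisticToContinuum-9141`, wanted by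
  `OddSectorIrreversibility`, `TransferKernelPositivity`, `LocalOhmBV`, `MatthiessenLadder`): the
  transfer glue `TransferToBoundedResponse` is PROVED in tree (`transferToBoundedResponse_proof`), so the
  route outputs `BoundedResponse`, and "bounded + (positive-or-infinite limit)" = "bounded ⇒ positive
  real limit".
* `closes_of_boundedResponseConverges` — the deciding theorem of the route with the slot REPLACED by
  `BoundedResponseConverges` (and the proved transfer glue discharged):
  `SubdiffusiveBondHeat → ExtensiveSnapshotIrreversibility → LinearResponseFTUR → NessUnique →
  FiniteResponseOfUnique → BoundedResponseConverges → FouriersLaw`, sorry-free, same axioms as `closes`.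

Nothing here closes item 9128.
-/

namespace Summit.AtomisticToContinuum.FouriersLaw.Theorems.PositiveOrInfiniteLimit

open Summit.AtomisticToContinuum.FouriersLaw.Theses

/-- **Along route `BondHeatUncertainty` the import slot is exactly `BoundedResponseConverges`.**  Given
(S), (K), (★) and weak-NESS uniqueness, `PositiveOrInfiniteLimit ↔ LocalOhmBV.BoundedResponseConverges`:
(⇒) is unconditional (`boundedResponseConverges_of_positiveOrInfiniteLimit`: a bounded sequence with an
`EReal` limit `> 0` has a positive real limit); (⇐) uses the route's output `BoundedResponse`, obtained from
the PROVED transfer glue `transferToBoundedResponse_proof` fed with the four hypotheses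
(`positiveOrInfiniteLimit_of_route_and_boundedResponseConverges`). [folklore] -/
theorem positiveOrInfiniteLimit_iff_boundedResponseConverges_of_route
    (hS : BondHeatUncertainty.SubdiffusiveBondHeat)
    (hK : BondHeatUncertainty.ExtensiveSnapshotIrreversibility)
    (hF : BondHeatUncertainty.LinearResponseFTUR) (hU : BondHeatUncertainty.NessUnique) :
    BondHeatUncertainty.PositiveOrInfiniteLimit ↔ LocalOhmBV.BoundedResponseConverges :=
  ⟨boundedResponseConverges_of_positiveOrInfiniteLimit, fun hC =>
    positiveOrInfiniteLimit_of_route_and_boundedResponseConverges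
      Summit.AtomisticToContinuum.FouriersLaw.Theorems.transferToBoundedResponse_proof hS hK hF hU hC⟩

/-- **Re-pointed deciding theorem of route `BondHeatUncertainty`.**  The three cruxes (S), (K), (★),
weak-NESS uniqueness, existence of the finite-`N` response limits and the SHARED crux
`LocalOhmBV.BoundedResponseConverges` (item 9141) — in place of the import slot `PositiveOrInfiniteLimit`
(item 9128) — imply the sub-problem statement `FouriersLaw`.  Proof: the route's deciding theorem
`BondHeatUncertainty.closes`, with the transfer glue discharged by `transferToBoundedResponse_proof` and
the slot supplied by `positiveOrInfiniteLimit_of_route_and_boundedResponseConverges`. [folklore] -/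
theorem closes_of_boundedResponseConverges
    (hS : BondHeatUncertainty.SubdiffusiveBondHeat)
    (hK : BondHeatUncertainty.ExtensiveSnapshotIrreversibility)
    (hF : BondHeatUncertainty.LinearResponseFTUR) (hU : BondHeatUncertainty.NessUnique)
    (hR : BondHeatUncertainty.FiniteResponseOfUnique) (hC : LocalOhmBV.BoundedResponseConverges) :
    FouriersLaw :=
  BondHeatUncertainty.closes
    Summit.AtomisticToContinuum.FouriersLaw.Theorems.transferToBoundedResponse_proof hS hK hF hU hR
    (positiveOrInfiniteLimit_of_route_and_boundedResponseConverges
      Summit.AtomisticToContinuum.FouriersLaw.Theorems.transferToBoundedResponse_proof hS hK hF hU hC)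

end Summit.AtomisticToContinuum.FouriersLaw.Theorems.PositiveOrInfiniteLimit
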